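import Summits.QuantumFields.YangMills.Theorems.BlockPlaquetteLinearisationLocal
import Summits.QuantumFields.YangMills.Theorems.UnitScaleGibbsBlockPlaquetteSmallFieldCone
import Summits.QuantumFields.YangMills.Theorems.UnitScaleGibbsBlockPlaquetteTransportFreeLinearisation
import HarnessLib

/-!
# `UnitScaleGibbsBlockPlaquetteTransportFreeLinearisationLocal` — THE j-FOLD, TRANSPORT-FREE LINEARISATION OF A BLOCK PLAQUETTE ON A CONE OF
# WALK HULLS: `V̄^{j}(∂q) − 1 = Σ_p linWeight j q p • (V(∂p) − 1) + O(ρ_j)` with hypotheses ONLY near the iterated block centres below `q`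
# ((M3♭) ✓`UnitScaleGibbsBlockPlaquetteTransportFreeLinearisation`, LOCAL EDITION — S_lin ∕ `stub_linTest` of LINE 28 «gross-sd-transfer»; crux
# `UnitScaleTilt.HistoryTailL`, stmt-QuantumFields-19936)

Cell `ym3-torus` (YM ladder rung R3 = continuum SU(2) Yang–Mills on T³ — a RUNG, NOT the Clay problem: not d = 4, not infinite volume, not a
mass gap), width seat `ym-ust-19936-w2` (gen 14).  Construction C3 of `GrossTransferAnnex4.md` §0 and LINE 28 skeleton v1 (`stub_linTest`, ideator
`ym-r3-idea-2` g16) read the `j`-fold block plaquette on the AXIAL-GAUGE REPRESENTATIVE OF A NON-WRAPPING BOX of side `n ≤ C·L^{j}`, on the level-0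
small-field event OF THAT BOX.  The global edition ✓`norm_iter_plaqHol_sub_one_sub_linProxy_le` (hypotheses on every plaquette and every transporter
of the torus) cannot be instantiated there.  THIS FILE proves the same induction with every hypothesis restricted to a CONE OF WALK HULLS below the
target plaquette: data a family of centres `c i : Site P i` with `c i = emb (c (i+1))` (the iterated block centres below `q₋ = walkEnd (c j) v`) and
radii `R i` with `L·R(i+1) + (d+4)L + 2 ≤ R i` (one averaging step reads the walk hull of radius `(d+4)L + 2` around `emb p′₋`, and
`emb (walkEnd y v) = walkEnd (emb y) (v.flatMap (replicate L))`, ✓`Prop7FlatHolonomy.walkEnd_emb_flatMap` — so a walk of length `≤ R(i+1)` at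
level `i+1` followed by the one-step hull is a walk of length `≤ R i` at level `i`).  With `R j = 0` one may take `R i ≤ 2(d+5)·L^{j−i}`: a box of
side `≍ L^{j}` fine steps around `embIter`-centre of `q`, as the line card says.

WHAT THIS FILE PROVES (kernel; 0 `def`, 0 `sorry`; engines BY NAME: the local (S) ✓`BlockPlaquetteLinearisationLocal.norm_plaqHol_avgFun_sub_one_sub_fullLin_proxy_le_loc`,
the weights ✓`UnitScaleGibbsBlockPlaquetteLinWeightDefs.sum_linWeight_zero_smul ∕ sum_linWeight_succ_smul`, the transport-removal mean
✓`UnitScaleGibbsBlockPlaquetteTransportFreeLinearisation.norm_mean_triple_sum_le`, the cone-crossing ✓`UnitScaleGibbsBlockPlaquetteSmallFieldCone.walkEnd_emb_walkEnd_eq`):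
* §2 ★★ `norm_plaqHol_avgFun_sub_one_sub_linProxy_succ_le_loc` — ONE level: plaquette smallness and the level-`i` linearisation remainder asked on
  the walk hull of radius `(d+4)L + 2` around `emb y`, the one-step transporters asked AT `y` for the target's directions only; bound
  `143s² + (L²a)² + L²ρ + L²·2τ(a + ρ)` as in the global edition;
* §3 ★★★ `norm_iter_plaqHol_sub_one_sub_linProxy_le_loc` — the `j`-fold induction on the cone `(c, R)`.
The feeds (level-`i` plaquette sizes `a i` and transporter sizes `τ i = (d+4)L·η i` from level-0 plaquette and BOND smallness on the base hull) are
✓`UnitScaleGibbsBlockPlaquetteSmallFieldCone.smallFieldCone ∕ smallFieldCone_transporter`; the flux identification of `Σ_p linWeight j q p • (V(∂p) − 1)`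
(S_test) is not here.

HONEST FRAMING.  Deterministic lattice bookkeeping on the tree's own objects (`--supports stmt-QuantumFields-19936`); crude hull radii; proves no
stub, crux, rung or summit statement; `stub_linTest`, «ShallowFluxSecondMomentL», (Q), K1, `MeanDeviationL`, `HistoryTailL` are NOT proved; the
Yang–Mills mass gap is NOT proved.

References: [Balaban1985Averaging] T. Bałaban, CMP 98 (1985) 17–51, (47)–(48) and Prop. 1 (51) pp. 25–26 («it is a local result»), (124) p. 36;
[Balaban1987RG1] T. Bałaban, CMP 109 (1987) 249–301, (0.1)–(0.4), (0.11) pp. 251–253.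
-/

noncomputable section

set_option autoImplicit false

open scoped BigOperators

namespace Summit.QuantumFields.YangMills.Theorems.UnitScaleGibbsBlockPlaquetteTransportFreeLinearisationLocal

open Literature.MathematicalPhysics.QuantumFieldTheory.Balaban1983to89
open Literature.MathematicalPhysics.QuantumFieldTheory.Balaban1983to89.B10Eq47AxialChi (shiftN rowProd)
open Literature.MathematicalPhysics.QuantumFieldTheory.Balaban1983to89.BlockAveraging (avgFun off blockAvg)
open Literature.MathematicalPhysics.QuantumFieldTheory.Balaban1983to89.ExpMeanLog (expMeanLogSU deltaSU)
open T4Continuum (holAt walk walkEnd stairWord Letter)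
open Summit.QuantumFields.YangMills.Theorems.UnitScaleGibbsBlockPlaquetteLinWeight
open Summit.QuantumFields.YangMills.Theorems.UnitScaleGibbsBlockPlaquetteTransportFreeLinearisation (norm_mean_triple_sum_le)
open Summit.QuantumFields.YangMills.Theorems.BlockPlaquetteLinearisationLocal (walkLocal_tile norm_plaqHol_avgFun_sub_one_sub_fullLin_proxy_le_loc)
open Summit.QuantumFields.YangMills.Theorems.Prop7HolRatioPerStep (norm_star_coe_eq_one)
open Summit.QuantumFields.YangMills.Theorems.UnitScaleGibbsBlockPlaquetteSmallFieldCone (walkEnd_emb_walkEnd_eq)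

variable {P : Params}

/-! ## §1 (Walk letters: the cone-crossing lemma `walkEnd_emb_walkEnd_eq` is ✓`UnitScaleGibbsBlockPlaquetteSmallFieldCone` §1.) -/

section Main

open scoped Matrix.Norms.L2Operator

variable {n : Type*} [Fintype n] [DecidableEq n] [Nonempty n]

/-! ## §2 One level, transport-free, walk-local -/

/-- ★★ **ONE LEVEL, TRANSPORT-FREE, WALK-LOCAL.**  Let `U` be a level-`i` field and `p′ = ⟨y; μ < ν⟩` a coarse plaquette.  If on the walk hull
`walkEnd (emb y) v`, `|v| ≤ (d+4)L + 2`, every plaquette of `U` is within `a ≥ 0` of `1` (`(((d+4)L)²/4)·a ≤ δ_N/2`) and every plaquette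
deviation is within `ρ` of the linear proxy `Σ_p w q p • X p`, and if the one-step transporters `T_J·T^J_{s,t}` of `U` AT `y` (directions `μ, ν`) are
within `τ` of `1` in `dist₁`, then the coarse plaquette deviation is within `143s² + (L²a)² + L²ρ + L²·2τ(a + ρ)` of the proxy with the one-level-up
weights `|J|⁻¹ Σ_J Σ_{t,s} w (p^J_{s,t}) p` (the local (S)-engine + transport removal + sum interchange; NO hypothesis off the hull).
[cite: Balaban1985Averaging, (47)-(48) pp.25-26 and (124) p.36; Balaban1987RG1, (0.3)-(0.4) pp.252-253] -/
theorem norm_plaqHol_avgFun_sub_one_sub_linProxy_succ_le_loc {i : ℕ} {a ρ τ : ℝ} (ha : 0 ≤ a)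
    {U : GaugeField P i (Matrix.specialUnitaryGroup n ℂ)}
    (hs : ((((P.d + 4) * P.L : ℕ) : ℝ) ^ 2 / 4) * a ≤ deltaSU n / 2) (y : Site P (i + 1)) {μ ν : Fin P.d} (hμν : μ < ν)
    (hU : ∀ v : List (Letter P.d), v.length ≤ (P.d + 4) * P.L + 2 →
      ∀ (a' b : Fin P.d) (h : a' < b), dist1 (GaugeField.plaqHol U ⟨walkEnd (emb y) v, a', b, h⟩) ≤ a)
    (w : Plaq P i → Plaq P 0 → ℝ) (X : Plaq P 0 → Matrix n n ℂ)
    (hw : ∀ v : List (Letter P.d), v.length ≤ (P.d + 4) * P.L + 2 → ∀ (a' b : Fin P.d) (h : a' < b),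
      ‖(((GaugeField.plaqHol U ⟨walkEnd (emb y) v, a', b, h⟩ : Matrix.specialUnitaryGroup n ℂ) : Matrix n n ℂ) - 1) -
        ∑ p : Plaq P 0, ((w ⟨walkEnd (emb y) v, a', b, h⟩ p : ℝ) : ℂ) • X p‖ ≤ ρ)
    (hτ : ∀ (J : (Fin P.d → Fin P.L) × Equiv.Perm (Fin P.d) × Equiv.Perm (Fin P.d) × Equiv.Perm (Fin P.d) × Equiv.Perm (Fin P.d)) (t s : ℕ),
      t < P.L → s < P.L →
      dist1 (holAt U (walk (emb y) (stairWord J.2.1 (off J.1))) *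
        (rowProd U (walkEnd (emb y) (stairWord J.2.1 (off J.1))) ν t *
          rowProd U (shiftN (walkEnd (emb y) (stairWord J.2.1 (off J.1))) ν t) μ s)) ≤ τ) :
    ‖(((GaugeField.plaqHol (avgFun (expMeanLogSU (n := n)) U) ⟨y, μ, ν, hμν⟩ : Matrix.specialUnitaryGroup n ℂ) : Matrix n n ℂ) - 1) -
        ((Fintype.card ((Fin P.d → Fin P.L) × Equiv.Perm (Fin P.d) × Equiv.Perm (Fin P.d) × Equiv.Perm (Fin P.d) ×
          Equiv.Perm (Fin P.d)) : ℂ))⁻¹ •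
          ∑ J : (Fin P.d → Fin P.L) × Equiv.Perm (Fin P.d) × Equiv.Perm (Fin P.d) × Equiv.Perm (Fin P.d) × Equiv.Perm (Fin P.d),
            ∑ t ∈ Finset.range P.L, ∑ s ∈ Finset.range P.L,
              ∑ p : Plaq P 0, ((w ⟨shiftN (shiftN (walkEnd (emb y) (stairWord J.2.1 (off J.1))) ν t) μ s, μ, ν, hμν⟩ p : ℝ) : ℂ) • X p‖ ≤
      143 * (((((P.d + 4) * P.L : ℕ) : ℝ) ^ 2 / 4) * a) ^ 2 + (((P.L * P.L : ℕ) : ℝ) * a) ^ 2 + ((P.L * P.L : ℕ) : ℝ) * ρ +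
        ((P.L * P.L : ℕ) : ℝ) * (2 * τ * (a + ρ)) := by
  -- adapted from the global edition ✓`UnitScaleGibbsBlockPlaquetteTransportFreeLinearisation.norm_plaqHol_avgFun_sub_one_sub_linProxy_succ_le`
  haveI : Nonempty (Fin P.d → Fin P.L) := ⟨fun _ => ⟨0, P.L_pos⟩⟩
  have h5 : (P.d + 4) * P.L ≤ (P.d + 4) * P.L + 2 := by omega
  -- the proxy and its remainder (global definitions; only their sizes on the hull are used)
  set A : Plaq P i → Matrix n n ℂ := fun q => ∑ p : Plaq P 0, ((w q p : ℝ) : ℂ) • X p with hA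
  set R : Plaq P i → Matrix n n ℂ := fun q => (((GaugeField.plaqHol U q : Matrix.specialUnitaryGroup n ℂ) : Matrix n n ℂ) - 1) - A q with hR
  have hAR : ∀ q : Plaq P i, (((GaugeField.plaqHol U q : Matrix.specialUnitaryGroup n ℂ) : Matrix n n ℂ) - 1) = A q + R q := fun q => by
    simp only [hR]; abel
  have hRρ : ∀ v : List (Letter P.d), v.length ≤ (P.d + 4) * P.L + 2 → ∀ (a' b : Fin P.d) (h : a' < b),
      ‖R ⟨walkEnd (emb y) v, a', b, h⟩‖ ≤ ρ := fun v hv a' b h => hw v hv a' b h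
  have hAloc : ∀ v : List (Letter P.d), v.length ≤ (P.d + 4) * P.L + 2 → ∀ (a' b : Fin P.d) (h : a' < b),
      ‖A ⟨walkEnd (emb y) v, a', b, h⟩‖ ≤ a + ρ := fun v hv a' b h => by
    have e : A ⟨walkEnd (emb y) v, a', b, h⟩ =
        (((GaugeField.plaqHol U ⟨walkEnd (emb y) v, a', b, h⟩ : Matrix.specialUnitaryGroup n ℂ) : Matrix n n ℂ) - 1) -
          R ⟨walkEnd (emb y) v, a', b, h⟩ := by rw [hAR]; abel
    rw [e]
    refine (norm_sub_le _ _).trans (add_le_add ?_ (hRρ v hv a' b h))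
    rw [← FederbushMean.dist1_SU_eq]; exact hU v hv a' b h
  -- the local engine
  have hK := norm_plaqHol_avgFun_sub_one_sub_fullLin_proxy_le_loc ha hs y hμν hU A R hAR hRρ
  -- transport removal, term by term
  set T : (Fin P.d → Fin P.L) × Equiv.Perm (Fin P.d) × Equiv.Perm (Fin P.d) × Equiv.Perm (Fin P.d) × Equiv.Perm (Fin P.d) → ℕ → ℕ →
      Matrix.specialUnitaryGroup n ℂ := fun J t s =>
    holAt U (walk (emb y) (stairWord J.2.1 (off J.1))) *
      (rowProd U (walkEnd (emb y) (stairWord J.2.1 (off J.1))) ν t *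
        rowProd U (shiftN (walkEnd (emb y) (stairWord J.2.1 (off J.1))) ν t) μ s) with hT
  set q : (Fin P.d → Fin P.L) × Equiv.Perm (Fin P.d) × Equiv.Perm (Fin P.d) × Equiv.Perm (Fin P.d) × Equiv.Perm (Fin P.d) → ℕ → ℕ → Plaq P i :=
    fun J t s => ⟨shiftN (shiftN (walkEnd (emb y) (stairWord J.2.1 (off J.1))) ν t) μ s, μ, ν, hμν⟩ with hq
  have hAq : ∀ (J : (Fin P.d → Fin P.L) × Equiv.Perm (Fin P.d) × Equiv.Perm (Fin P.d) × Equiv.Perm (Fin P.d) × Equiv.Perm (Fin P.d))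
      (t : ℕ), t < P.L → ∀ s, s < P.L → ‖A (q J t s)‖ ≤ a + ρ := fun J t ht s hs' =>
    walkLocal_tile (fun q' => ‖A q'‖) y h5 hAloc hμν J.2.1 J.1 t ht s hs'
  -- transport removal `‖T·X·T* − X‖ ≤ 2‖T − 1‖‖X‖` (the tree's ✓`NewtonLiftFramed.norm_conj_sub_self_le`, re-derived locally to keep the import closure small)
  have hconj : ∀ (T : Matrix.specialUnitaryGroup n ℂ) (X : Matrix n n ℂ),
      ‖(T : Matrix n n ℂ) * X * star (T : Matrix n n ℂ) - X‖ ≤ 2 * ‖(T : Matrix n n ℂ) - 1‖ * ‖X‖ := fun T X => by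
    have e : (T : Matrix n n ℂ) * X * star (T : Matrix n n ℂ) - X =
        ((T : Matrix n n ℂ) - 1) * X * star (T : Matrix n n ℂ) + X * (star (T : Matrix n n ℂ) - 1) := by noncomm_ring
    rw [e]
    calc ‖((T : Matrix n n ℂ) - 1) * X * star (T : Matrix n n ℂ) + X * (star (T : Matrix n n ℂ) - 1)‖
        ≤ ‖(T : Matrix n n ℂ) - 1‖ * ‖X‖ * ‖star (T : Matrix n n ℂ)‖ + ‖X‖ * ‖star (T : Matrix n n ℂ) - 1‖ :=
          (norm_add_le _ _).trans (add_le_add ((norm_mul_le _ _).trans (mul_le_mul_of_nonneg_right (norm_mul_le _ _) (norm_nonneg _)))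
            (norm_mul_le _ _))
      _ = 2 * ‖(T : Matrix n n ℂ) - 1‖ * ‖X‖ := by rw [norm_star_coe_eq_one, ExpMeanLog.norm_star_sub_one]; ring
  have hdiff : ‖((Fintype.card ((Fin P.d → Fin P.L) × Equiv.Perm (Fin P.d) × Equiv.Perm (Fin P.d) × Equiv.Perm (Fin P.d) ×
          Equiv.Perm (Fin P.d)) : ℂ))⁻¹ •
          ∑ J : (Fin P.d → Fin P.L) × Equiv.Perm (Fin P.d) × Equiv.Perm (Fin P.d) × Equiv.Perm (Fin P.d) × Equiv.Perm (Fin P.d),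
            ∑ t ∈ Finset.range P.L, ∑ s ∈ Finset.range P.L,
              (((T J t s : Matrix.specialUnitaryGroup n ℂ) : Matrix n n ℂ) * A (q J t s) * star ((T J t s : Matrix.specialUnitaryGroup n ℂ) : Matrix n n ℂ) -
                A (q J t s))‖ ≤ ((P.L * P.L : ℕ) : ℝ) * (2 * τ * (a + ρ)) := by
    refine norm_mean_triple_sum_le _ fun J t ht s hs' => ?_
    refine (hconj (T J t s) (A (q J t s))).trans ?_
    have h1 : ‖((T J t s : Matrix.specialUnitaryGroup n ℂ) : Matrix n n ℂ) - 1‖ ≤ τ := by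
      have h := hτ J t s ht hs'
      rw [FederbushMean.dist1_SU_eq] at h
      exact h
    have h2 := hAq J t ht s hs'
    have hτ0 : 0 ≤ τ := (GaugeGroup.dist1_nonneg _).trans (hτ J t s ht hs')
    calc 2 * ‖((T J t s : Matrix.specialUnitaryGroup n ℂ) : Matrix n n ℂ) - 1‖ * ‖A (q J t s)‖ ≤ 2 * τ * (a + ρ) := by
          gcongr
    _ = 2 * τ * (a + ρ) := rfl
  -- assemble: (full transported sum) − (transport-free sum) = the mean of the differences
  have esplit : ((Fintype.card ((Fin P.d → Fin P.L) × Equiv.Perm (Fin P.d) × Equiv.Perm (Fin P.d) × Equiv.Perm (Fin P.d) ×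
          Equiv.Perm (Fin P.d)) : ℂ))⁻¹ •
          ∑ J : (Fin P.d → Fin P.L) × Equiv.Perm (Fin P.d) × Equiv.Perm (Fin P.d) × Equiv.Perm (Fin P.d) × Equiv.Perm (Fin P.d),
            ∑ t ∈ Finset.range P.L, ∑ s ∈ Finset.range P.L,
              ((T J t s : Matrix.specialUnitaryGroup n ℂ) : Matrix n n ℂ) * A (q J t s) * star ((T J t s : Matrix.specialUnitaryGroup n ℂ) : Matrix n n ℂ) -
        ((Fintype.card ((Fin P.d → Fin P.L) × Equiv.Perm (Fin P.d) × Equiv.Perm (Fin P.d) × Equiv.Perm (Fin P.d) ×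
          Equiv.Perm (Fin P.d)) : ℂ))⁻¹ •
          ∑ J : (Fin P.d → Fin P.L) × Equiv.Perm (Fin P.d) × Equiv.Perm (Fin P.d) × Equiv.Perm (Fin P.d) × Equiv.Perm (Fin P.d),
            ∑ t ∈ Finset.range P.L, ∑ s ∈ Finset.range P.L, A (q J t s) =
      ((Fintype.card ((Fin P.d → Fin P.L) × Equiv.Perm (Fin P.d) × Equiv.Perm (Fin P.d) × Equiv.Perm (Fin P.d) ×
          Equiv.Perm (Fin P.d)) : ℂ))⁻¹ •
          ∑ J : (Fin P.d → Fin P.L) × Equiv.Perm (Fin P.d) × Equiv.Perm (Fin P.d) × Equiv.Perm (Fin P.d) × Equiv.Perm (Fin P.d),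
            ∑ t ∈ Finset.range P.L, ∑ s ∈ Finset.range P.L,
              (((T J t s : Matrix.specialUnitaryGroup n ℂ) : Matrix n n ℂ) * A (q J t s) * star ((T J t s : Matrix.specialUnitaryGroup n ℂ) : Matrix n n ℂ) -
                A (q J t s)) := by
    rw [← smul_sub, ← Finset.sum_sub_distrib]
    congr 1
    refine Finset.sum_congr rfl fun J _ => ?_
    rw [← Finset.sum_sub_distrib]
    refine Finset.sum_congr rfl fun t _ => ?_
    rw [← Finset.sum_sub_distrib]
  -- the target's proxy term IS the transport-free sum (definitionally, through `hA`/`hq`)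
  have key := norm_sub_le_norm_sub_add_norm_sub
    ((((GaugeField.plaqHol (avgFun (expMeanLogSU (n := n)) U) ⟨y, μ, ν, hμν⟩ : Matrix.specialUnitaryGroup n ℂ) : Matrix n n ℂ) - 1))
    (((Fintype.card ((Fin P.d → Fin P.L) × Equiv.Perm (Fin P.d) × Equiv.Perm (Fin P.d) × Equiv.Perm (Fin P.d) ×
          Equiv.Perm (Fin P.d)) : ℂ))⁻¹ •
          ∑ J : (Fin P.d → Fin P.L) × Equiv.Perm (Fin P.d) × Equiv.Perm (Fin P.d) × Equiv.Perm (Fin P.d) × Equiv.Perm (Fin P.d),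
            ∑ t ∈ Finset.range P.L, ∑ s ∈ Finset.range P.L,
              ((T J t s : Matrix.specialUnitaryGroup n ℂ) : Matrix n n ℂ) * A (q J t s) * star ((T J t s : Matrix.specialUnitaryGroup n ℂ) : Matrix n n ℂ))
    (((Fintype.card ((Fin P.d → Fin P.L) × Equiv.Perm (Fin P.d) × Equiv.Perm (Fin P.d) × Equiv.Perm (Fin P.d) ×
          Equiv.Perm (Fin P.d)) : ℂ))⁻¹ •
          ∑ J : (Fin P.d → Fin P.L) × Equiv.Perm (Fin P.d) × Equiv.Perm (Fin P.d) × Equiv.Perm (Fin P.d) × Equiv.Perm (Fin P.d),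
            ∑ t ∈ Finset.range P.L, ∑ s ∈ Finset.range P.L, A (q J t s))
  rw [esplit] at key
  have hK' : ‖(((GaugeField.plaqHol (avgFun (expMeanLogSU (n := n)) U) ⟨y, μ, ν, hμν⟩ : Matrix.specialUnitaryGroup n ℂ) : Matrix n n ℂ) - 1) -
      ((Fintype.card ((Fin P.d → Fin P.L) × Equiv.Perm (Fin P.d) × Equiv.Perm (Fin P.d) × Equiv.Perm (Fin P.d) ×
          Equiv.Perm (Fin P.d)) : ℂ))⁻¹ •
          ∑ J : (Fin P.d → Fin P.L) × Equiv.Perm (Fin P.d) × Equiv.Perm (Fin P.d) × Equiv.Perm (Fin P.d) × Equiv.Perm (Fin P.d),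
            ∑ t ∈ Finset.range P.L, ∑ s ∈ Finset.range P.L,
              ((T J t s : Matrix.specialUnitaryGroup n ℂ) : Matrix n n ℂ) * A (q J t s) * star ((T J t s : Matrix.specialUnitaryGroup n ℂ) : Matrix n n ℂ)‖ ≤
      143 * (((((P.d + 4) * P.L : ℕ) : ℝ) ^ 2 / 4) * a) ^ 2 + (((P.L * P.L : ℕ) : ℝ) * a) ^ 2 + ((P.L * P.L : ℕ) : ℝ) * ρ := by
    simpa only [hT, hq] using hK
  have hgoal : ‖(((GaugeField.plaqHol (avgFun (expMeanLogSU (n := n)) U) ⟨y, μ, ν, hμν⟩ : Matrix.specialUnitaryGroup n ℂ) : Matrix n n ℂ) - 1) -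
      ((Fintype.card ((Fin P.d → Fin P.L) × Equiv.Perm (Fin P.d) × Equiv.Perm (Fin P.d) × Equiv.Perm (Fin P.d) ×
          Equiv.Perm (Fin P.d)) : ℂ))⁻¹ •
          ∑ J : (Fin P.d → Fin P.L) × Equiv.Perm (Fin P.d) × Equiv.Perm (Fin P.d) × Equiv.Perm (Fin P.d) × Equiv.Perm (Fin P.d),
            ∑ t ∈ Finset.range P.L, ∑ s ∈ Finset.range P.L, A (q J t s)‖ ≤
      143 * (((((P.d + 4) * P.L : ℕ) : ℝ) ^ 2 / 4) * a) ^ 2 + (((P.L * P.L : ℕ) : ℝ) * a) ^ 2 + ((P.L * P.L : ℕ) : ℝ) * ρ +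
        ((P.L * P.L : ℕ) : ℝ) * (2 * τ * (a + ρ)) := by
    linarith [key, hK', hdiff]
  simpa only [hA, hq] using hgoal

/-! ## §3 The `j`-fold induction on a cone of walk hulls -/

/-- ★★★ **THE j-FOLD, TRANSPORT-FREE LINEARISATION OF A BLOCK PLAQUETTE ON A CONE OF WALK HULLS.**  Let `V : GaugeField P 0 SU(N)`,
`V̄^{i} := Averaging.iter (blockAvg expMeanLogSU) i V`, and let `c i : Site P i`, `R i : ℕ` be centres and radii with `c i = emb (c (i+1))` and
`L·R(i+1) + (d+4)L + 2 ≤ R i` for `i < j` (the CONE below the level-`j` hull `walkEnd (c j) v`, `|v| ≤ R j`).  Suppose that for every `i < j`: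
(a) every plaquette of `V̄^{i}` cornered at `walkEnd (c i) v`, `|v| ≤ R i`, is within `a i` of `1`, `0 ≤ a i`, `(((d+4)L)²/4)·a i ≤ δ_N/2`;
(b) for every coarse site `y = walkEnd (c (i+1)) v`, `|v| ≤ R(i+1)`, all directions `μ < ν` and all `J, t, s < L`, the one-step transporter
`holAt V̄^{i} (walk (emb y) (stairWord σ (off r))) · rowProd V̄^{i} x_J ν t · rowProd V̄^{i} (x_J + t e_ν) μ s` is within `τ i` of `1` in `dist₁`;
(c) `0 ≤ ρ 0` and `143·s_i² + (L²·a_i)² + L²·ρ i + L²·(2·τ_i·(a_i + ρ i)) ≤ ρ (i+1)`.  Then for every plaquette `q = ⟨walkEnd (c j) v; μ < ν⟩`,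
`|v| ≤ R j`, of level `j`:
  `‖(V̄^{j}(∂q) : M) − 1 − Σ_{p : Plaq P 0} linWeight j q p • ((V(∂p) : M) − 1)‖ ≤ ρ j`
— with NO hypothesis outside the cone (C3: on the axial-gauge representative of a box all these transporters are near `1` and all these plaquettes
small on the box's small-field event). [cite: Balaban1985Averaging, (47)-(48) pp.25-26 and (124) p.36; Balaban1987RG1, (0.1)-(0.4) and (0.11) pp.251-253] -/
theorem norm_iter_plaqHol_sub_one_sub_linProxy_le_loc (V : GaugeField P 0 (Matrix.specialUnitaryGroup n ℂ)) (a τ ρ : ℕ → ℝ)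
    (c : (i : ℕ) → Site P i) (R : ℕ → ℕ) :
    ∀ j : ℕ,
      (∀ i, i < j → c i = emb (c (i + 1))) →
      (∀ i, i < j → P.L * R (i + 1) + ((P.d + 4) * P.L + 2) ≤ R i) →
      (∀ i, i < j → 0 ≤ a i) →
      (∀ i, i < j → ∀ v : List (Letter P.d), v.length ≤ R i → ∀ (a' b : Fin P.d) (h : a' < b),
        dist1 (GaugeField.plaqHol (Averaging.iter (fun i' => blockAvg (P := P) (j := i') (expMeanLogSU (n := n))) i V)
          ⟨walkEnd (c i) v, a', b, h⟩) ≤ a i) →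
      (∀ i, i < j → ((((P.d + 4) * P.L : ℕ) : ℝ) ^ 2 / 4) * a i ≤ deltaSU n / 2) →
      (∀ i, i < j → ∀ v : List (Letter P.d), v.length ≤ R (i + 1) → ∀ (μ ν : Fin P.d)
        (J : (Fin P.d → Fin P.L) × Equiv.Perm (Fin P.d) × Equiv.Perm (Fin P.d) × Equiv.Perm (Fin P.d) × Equiv.Perm (Fin P.d)) (t s : ℕ),
        t < P.L → s < P.L →
        dist1 (holAt (Averaging.iter (fun i' => blockAvg (P := P) (j := i') (expMeanLogSU (n := n))) i V)
            (walk (emb (walkEnd (c (i + 1)) v)) (stairWord J.2.1 (off J.1))) *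
          (rowProd (Averaging.iter (fun i' => blockAvg (P := P) (j := i') (expMeanLogSU (n := n))) i V)
              (walkEnd (emb (walkEnd (c (i + 1)) v)) (stairWord J.2.1 (off J.1))) ν t *
            rowProd (Averaging.iter (fun i' => blockAvg (P := P) (j := i') (expMeanLogSU (n := n))) i V)
              (shiftN (walkEnd (emb (walkEnd (c (i + 1)) v)) (stairWord J.2.1 (off J.1))) ν t) μ s)) ≤ τ i) →
      0 ≤ ρ 0 →
      (∀ i, i < j → 143 * (((((P.d + 4) * P.L : ℕ) : ℝ) ^ 2 / 4) * a i) ^ 2 + (((P.L * P.L : ℕ) : ℝ) * a i) ^ 2 +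
        ((P.L * P.L : ℕ) : ℝ) * ρ i + ((P.L * P.L : ℕ) : ℝ) * (2 * τ i * (a i + ρ i)) ≤ ρ (i + 1)) →
      ∀ v : List (Letter P.d), v.length ≤ R j → ∀ (μ ν : Fin P.d) (hμν : μ < ν),
        ‖(((GaugeField.plaqHol (Averaging.iter (fun i' => blockAvg (P := P) (j := i') (expMeanLogSU (n := n))) j V)
              ⟨walkEnd (c j) v, μ, ν, hμν⟩ : Matrix.specialUnitaryGroup n ℂ) : Matrix n n ℂ) - 1) -
          ∑ p : Plaq P 0, ((linWeight j ⟨walkEnd (c j) v, μ, ν, hμν⟩ p : ℝ) : ℂ) •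
            ((((GaugeField.plaqHol V p : Matrix.specialUnitaryGroup n ℂ)) : Matrix n n ℂ) - 1)‖ ≤ ρ j
  | 0, _, _, _, _, _, _, hρ0, _, v, _, μ, ν, hμν => by
    have e : Averaging.iter (fun i' => blockAvg (P := P) (j := i') (expMeanLogSU (n := n))) 0 V = V := rfl
    rw [e, sum_linWeight_zero_smul, sub_self, norm_zero]
    exact hρ0
  | j + 1, hc, hR, ha, hplaq, hs, hτ, hρ0, hstep, v, hv, μ, ν, hμν => by
    -- the induction hypothesis at level `j`, on the hull of radius `R j` around `c j`
    have IH := norm_iter_plaqHol_sub_one_sub_linProxy_le_loc V a τ ρ c R j (fun i hi => hc i (Nat.lt_succ_of_lt hi))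
      (fun i hi => hR i (Nat.lt_succ_of_lt hi)) (fun i hi => ha i (Nat.lt_succ_of_lt hi)) (fun i hi => hplaq i (Nat.lt_succ_of_lt hi))
      (fun i hi => hs i (Nat.lt_succ_of_lt hi)) (fun i hi => hτ i (Nat.lt_succ_of_lt hi)) hρ0 (fun i hi => hstep i (Nat.lt_succ_of_lt hi))
    have hj := Nat.lt_succ_self j
    -- crossing one level: the one-step hull around `emb (walkEnd (c (j+1)) v)` lies in the level-`j` hull of radius `R j` around `c j`
    have hcross : ∀ v'' : List (Letter P.d), v''.length ≤ (P.d + 4) * P.L + 2 →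
        ∃ u : List (Letter P.d), u.length ≤ R j ∧ walkEnd (emb (walkEnd (c (j + 1)) v)) v'' = walkEnd (c j) u :=
      fun v'' hv'' => walkEnd_emb_walkEnd_eq (hc j hj) (hR j hj) v hv v'' hv''
    have hU' : ∀ v'' : List (Letter P.d), v''.length ≤ (P.d + 4) * P.L + 2 → ∀ (a' b : Fin P.d) (h : a' < b),
        dist1 (GaugeField.plaqHol (Averaging.iter (fun i' => blockAvg (P := P) (j := i') (expMeanLogSU (n := n))) j V)
          ⟨walkEnd (emb (walkEnd (c (j + 1)) v)) v'', a', b, h⟩) ≤ a j := fun v'' hv'' a' b h => by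
      obtain ⟨u, hu, e⟩ := hcross v'' hv''
      rw [e]
      exact hplaq j hj u hu a' b h
    have hw' : ∀ v'' : List (Letter P.d), v''.length ≤ (P.d + 4) * P.L + 2 → ∀ (a' b : Fin P.d) (h : a' < b),
        ‖(((GaugeField.plaqHol (Averaging.iter (fun i' => blockAvg (P := P) (j := i') (expMeanLogSU (n := n))) j V)
              ⟨walkEnd (emb (walkEnd (c (j + 1)) v)) v'', a', b, h⟩ : Matrix.specialUnitaryGroup n ℂ) : Matrix n n ℂ) - 1) -
          ∑ p : Plaq P 0, ((linWeight j ⟨walkEnd (emb (walkEnd (c (j + 1)) v)) v'', a', b, h⟩ p : ℝ) : ℂ) •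
            ((((GaugeField.plaqHol V p : Matrix.specialUnitaryGroup n ℂ)) : Matrix n n ℂ) - 1)‖ ≤ ρ j := fun v'' hv'' a' b h => by
      obtain ⟨u, hu, e⟩ := hcross v'' hv''
      rw [e]
      exact IH u hu a' b h
    have e : Averaging.iter (fun i' => blockAvg (P := P) (j := i') (expMeanLogSU (n := n))) (j + 1) V =
        avgFun (expMeanLogSU (n := n)) (Averaging.iter (fun i' => blockAvg (P := P) (j := i') (expMeanLogSU (n := n))) j V) := rfl
    rw [e]
    have h1 := norm_plaqHol_avgFun_sub_one_sub_linProxy_succ_le_loc (ha j hj) (hs j hj) (walkEnd (c (j + 1)) v) hμν hU' (linWeight j)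
      (fun p => (((GaugeField.plaqHol V p : Matrix.specialUnitaryGroup n ℂ)) : Matrix n n ℂ) - 1) hw'
      (fun J t s ht hs' => hτ j hj v hv μ ν J t s ht hs')
    rw [sum_linWeight_succ_smul]
    exact h1.trans (hstep j hj)

end Main

end Summit.QuantumFields.YangMills.Theorems.UnitScaleGibbsBlockPlaquetteTransportFreeLinearisationLocal

end
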